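import Literature.Analysis.FunctionSpaces.TorusLinearisedNSEnergy
import Literature.Analysis.ODE.OneSidedComparison
import HarnessLib

/-!
# The linearised Navier–Stokes equation along a shear on the flat torus: energy growth by the
# time-integrated shear rate

Function-space support file (all results proved; no definitions, no named facts), a variable-rate
companion of `TorusLinearisedNSEnergy` (`Torus.linearisedNS_integral_norm_sq_le_mul_exp`: growth
`exp(2(∑ᵢCᵢ)(t − a))` under CONSTANT gradient bounds `‖∂ᵢu‖ ≤ Cᵢ`). Along a jointly smooth
divergence-free carrier `u` on `[a, b] × T^d` let `(w, q)` be a smooth solution of the linearised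
Navier–Stokes equation `∂ₜw + (u·∇)w + (w·∇)u = νΔw − ∇q`, `div w = 0` (Yoshida–Kaneda's model
(4)–(5) with `(α, β) = (1, 1)`; Constantin–Foias (14.2)–(14.4)). If `u(t, ·)` is a SHEAR — it varies
only with the `k`-th coordinate and `∂ₖu = c(t, x) eₘ` points along a fixed axis `m ≠ k` — with
`|c(t, x)| ≤ r(t)`, `r` continuous, then the production term obeys the pointwise bound
`2|⟪(w·∇)u, w⟫| = 2|c| |wₖ| |wₘ| ≤ |c| ‖w‖²` (`Torus.two_mul_abs_inner_convect_le_of_shear`), hence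
`d/dt ∫ ‖w‖² ≤ r(t) ∫ ‖w‖²` and

* `Torus.linearisedNS_integral_norm_sq_le_mul_exp_integral_of_shear` —
  `∫ ‖w(t)‖² ≤ (∫ ‖w(a)‖²) · exp(∫ₐᵗ r)` on `[a, b]`

(the energy identity `Torus.linearisedNS_hasDerivWithinAt_integral_norm_sq` and the variable-rate
Grönwall barrier `Torus.le_mul_exp_integral_of_deriv_le_mul`, proved here from the one-sided
comparison lemma `Literature.Analysis.ODE.le_of_deriv_right_nonpos`). For an alternating shear pulse of
total strain `∫ r = γ` and profile slope `≤ 1` this is the factor `e^γ` per half pulse (consumer: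
`Literature.Analysis.FluidPDE.SawtoothCascade`, the K3′ line's `HalfPulseEnergyBound` in its classical form).

## Mathlib / tree search

Tree: `Torus.linearisedNS_hasDerivWithinAt_integral_norm_sq`, `Torus.fderiv_apply_eq_sum_partialDeriv`,
`Torus.IsSmooth.norm_sq/.integrable` (reused); `lean search 'exp \(∫'` in `Literature/Analysis/ODE`: only the
integral-form Grönwall `Literature.Analysis.ODE.gronwall_integral_le` (continuous data on `[0, T]`), not the
differential form within `[a, b]` needed here. Mathlib: `le_gronwallBound_of_liminf_deriv_right_le` (constant
rate only), `abs_integral_le_integral_abs`, `integral_mono_of_nonneg`, `EuclideanSpace.inner_single_left`.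

## References

* K. Yoshida, Y. Kaneda, Phys. Rev. E 63 (2000) 016308, §II (4)–(5). [`YoshidaKaneda2000`]
* A. J. Majda, A. L. Bertozzi, *Vorticity and Incompressible Flow*, CUP 2002, §3.1.1, Prop. 3.1 and
  Lemma 3.1 (basic energy estimate; Grönwall's lemma). [`MajdaBertozziCUP2002`]
* P. Constantin, C. Foias, *Navier–Stokes Equations*, Univ. Chicago Press 1988, Ch. 14, (14.2)–(14.4).
  [`ConstantinFoiasNSE1988`]
-/

open MeasureTheory Set Filter
open scoped InnerProductSpace ContDiff Topology

noncomputable section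

namespace Literature.Analysis.FunctionSpaces

namespace Torus

variable {d : Type*} [Fintype d] [DecidableEq d]

/-! ## A variable-rate Grönwall barrier within a compact interval -/

section Gronwall

omit [Fintype d] [DecidableEq d]

/-- A primitive of a function continuous on `[a, b]`, differentiable WITHIN `[a, b]` (clamp, then FTC).
[folklore] -/
private theorem exists_hasDerivWithinAt_integral {F : ℝ → ℝ} {a b : ℝ} (hab : a ≤ b)
    (hF : ContinuousOn F (Icc a b)) :
    ∃ Φ : ℝ → ℝ, (∀ t ∈ Icc a b, HasDerivWithinAt Φ (F t) (Icc a b) t) ∧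
      ∀ t ∈ Icc a b, Φ t - Φ a = ∫ s in a..t, F s := by
  set Ft : ℝ → ℝ := fun s => F (max a (min b s)) with hFt
  have hmem : ∀ s, max a (min b s) ∈ Icc a b := fun s =>
    ⟨le_max_left _ _, max_le hab (min_le_left _ _)⟩
  have hFtc : Continuous Ft :=
    hF.comp_continuous (continuous_const.max (continuous_const.min continuous_id)) hmem
  have hFt_eq : ∀ s ∈ Icc a b, Ft s = F s := fun s hs => by
    simp only [hFt, min_eq_right hs.2, max_eq_right hs.1]
  refine ⟨fun t => ∫ s in a..t, Ft s, fun t ht => ?_, fun t ht => ?_⟩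
  · have h := (hFtc.integral_hasStrictDerivAt a t).hasDerivAt.hasDerivWithinAt (s := Icc a b)
    rwa [hFt_eq t ht] at h
  · simp only [intervalIntegral.integral_same, sub_zero]
    refine intervalIntegral.integral_congr fun s hs => hFt_eq s ?_
    rw [uIcc_of_le ht.1] at hs
    exact ⟨hs.1, hs.2.trans ht.2⟩

/-- **Variable-rate exponential barrier (Grönwall, differential form, within `[a, b]`).** If `E` has
derivative `E'` within `[a, b]` at every point of `[a, b]`, `E' ≤ r · E` there, and `r` is continuous on
`[a, b]`, then `E(t) ≤ E(a) · exp(∫ₐᵗ r)` for `t ∈ [a, b]` (no sign condition on `E` or `r`).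
[cite: MajdaBertozziCUP2002, Lemma 3.1 (Grönwall's lemma)] -/
theorem le_mul_exp_integral_of_deriv_le_mul {E E' r : ℝ → ℝ} {a b : ℝ}
    (hE : ∀ s ∈ Icc a b, HasDerivWithinAt E (E' s) (Icc a b) s)
    (hle : ∀ s ∈ Icc a b, E' s ≤ r s * E s) (hr : ContinuousOn r (Icc a b))
    {t : ℝ} (ht : t ∈ Icc a b) :
    E t ≤ E a * Real.exp (∫ s in a..t, r s) := by
  have hab : a ≤ b := ht.1.trans ht.2
  obtain ⟨R, hR, hRint⟩ := exists_hasDerivWithinAt_integral hab hr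
  set ψ : ℝ → ℝ := fun s => E s * Real.exp (-(R s - R a)) with hψ
  have hψd : ∀ s ∈ Icc a b, HasDerivWithinAt ψ
      (E' s * Real.exp (-(R s - R a)) + E s * (Real.exp (-(R s - R a)) * (-(r s)))) (Icc a b) s := by
    intro s hs
    have h1 : HasDerivWithinAt (fun s => Real.exp (-(R s - R a)))
        (Real.exp (-(R s - R a)) * (-(r s))) (Icc a b) s := by
      have h := (((hR s hs).sub_const (R a)).neg).exp
      simpa using h
    exact (hE s hs).mul h1
  have hψle : ∀ s ∈ Icc a b,
      E' s * Real.exp (-(R s - R a)) + E s * (Real.exp (-(R s - R a)) * (-(r s))) ≤ 0 := by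
    intro s hs
    have hex : 0 < Real.exp (-(R s - R a)) := Real.exp_pos _
    have : E' s * Real.exp (-(R s - R a)) + E s * (Real.exp (-(R s - R a)) * (-(r s))) =
        (E' s - r s * E s) * Real.exp (-(R s - R a)) := by ring
    rw [this]
    exact mul_nonpos_of_nonpos_of_nonneg (sub_nonpos.2 (hle s hs)) hex.le
  have hψc : ContinuousOn ψ (Icc a b) := fun s hs => (hψd s hs).continuousWithinAt
  have hψder : ∀ s ∈ Ico a b, HasDerivWithinAt ψ
      (E' s * Real.exp (-(R s - R a)) + E s * (Real.exp (-(R s - R a)) * (-(r s)))) (Ici s) s :=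
    fun s hs => ((hψd s (Ico_subset_Icc_self hs)).mono (Icc_subset_Icc hs.1 le_rfl)).mono_of_mem_nhdsWithin
      (Icc_mem_nhdsGE hs.2)
  have hmain := Literature.Analysis.ODE.le_of_deriv_right_nonpos hψc hψder
    (fun s hs => hψle s (Ico_subset_Icc_self hs)) t ht
  have hψa : ψ a = E a := by simp [hψ]
  have hEt : E t = ψ t * Real.exp (R t - R a) := by
    simp only [hψ]
    rw [mul_assoc, ← Real.exp_add, neg_add_cancel, Real.exp_zero, mul_one]
  rw [hEt, ← hRint t ht]
  calc ψ t * Real.exp (R t - R a) ≤ ψ a * Real.exp (R t - R a) := by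
        gcongr
    _ = E a * Real.exp (R t - R a) := by rw [hψa]

end Gronwall

/-! ## The production term of a shear -/

section Shear

/-- **Pointwise production bound for a shear.** Let `v : T^d → ℝ^d` be smooth and, at the point `x`,
depend only on the `k`-th coordinate to first order (`∂ᵢv(x) = 0` for `i ≠ k`) with `∂ₖv(x) = c · eₘ`
along a fixed axis `m ≠ k`. Then `(w·∇)v (x) = wₖ(x) c eₘ` and `2|⟪(w·∇)v, w⟫(x)| = 2|c| |wₖ| |wₘ| ≤ |c| ‖w(x)‖²`.
[cite: MajdaBertozziCUP2002, §3.1.1 Prop. 3.1 (energy estimate: the stretching term ⟪(w·∇)v, w⟫)] -/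
theorem two_mul_abs_inner_convect_le_of_shear {v w : UnitAddTorus d → EuclideanSpace ℝ d}
    (hv : IsSmooth v) {k m : d} (hkm : k ≠ m) {x : UnitAddTorus d} {c : ℝ}
    (h0 : ∀ i, i ≠ k → partialDeriv i v x = 0)
    (hk : partialDeriv k v x = c • EuclideanSpace.single m (1 : ℝ)) :
    2 * |⟪convect w v x, w x⟫_ℝ| ≤ |c| * ‖w x‖ ^ 2 := by
  have hconv : convect w v x = ∑ i, w x i • partialDeriv i v x :=
    fderiv_apply_eq_sum_partialDeriv (hv.isContDiff (by simp)) x (w x)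
  rw [Finset.sum_eq_single k (fun i _ hik => by rw [h0 i hik, smul_zero])
    (fun h => absurd (Finset.mem_univ k) h)] at hconv
  rw [hconv, hk, real_inner_smul_left, real_inner_smul_left, EuclideanSpace.inner_single_left]
  simp only [map_one, one_mul]
  have hsq : (w x k) ^ 2 + (w x m) ^ 2 ≤ ‖w x‖ ^ 2 := by
    rw [EuclideanSpace.norm_sq_eq]
    calc (w x k) ^ 2 + (w x m) ^ 2 = ∑ i ∈ ({k, m} : Finset d), ‖w x i‖ ^ 2 := by
          rw [Finset.sum_pair hkm, Real.norm_eq_abs, Real.norm_eq_abs, sq_abs, sq_abs]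
      _ ≤ ∑ i, ‖w x i‖ ^ 2 :=
          Finset.sum_le_sum_of_subset_of_nonneg (Finset.subset_univ _) fun i _ _ => sq_nonneg _
  rw [abs_mul, abs_mul]
  have h2 : 2 * (|w x k| * |w x m|) ≤ (w x k) ^ 2 + (w x m) ^ 2 := by
    nlinarith [sq_nonneg (|w x k| - |w x m|), sq_abs (w x k), sq_abs (w x m)]
  calc 2 * (|w x k| * (|c| * |w x m|)) = |c| * (2 * (|w x k| * |w x m|)) := by ring
    _ ≤ |c| * ((w x k) ^ 2 + (w x m) ^ 2) := by gcongr
    _ ≤ |c| * ‖w x‖ ^ 2 := by gcongr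

end Shear

/-! ## Energy growth along a shear with time-dependent rate -/

section Energy

variable {a b ν : ℝ} {u w : ℝ → UnitAddTorus d → EuclideanSpace ℝ d}
  {q : ℝ → UnitAddTorus d → ℝ}

/-- **Energy bound for the linearised Navier–Stokes equation along a shear with time-dependent rate.**
Let `u` be jointly smooth and divergence free on `[a, b] × T^d`, a shear in the sense `∂ᵢu(t, x) = 0`
(`i ≠ k`), `∂ₖu(t, x) = c(t, x) eₘ` (`m ≠ k`) with `|c(t, x)| ≤ r(t)`, `r` continuous on `[a, b]`; let
`(w, q)` be a smooth solution of `∂ₜw + (u·∇)w + (w·∇)u = νΔw − ∇q`, `div w = 0` on `[a, b]` (`ν ≥ 0`).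
Then `∫ ‖w(t)‖² ≤ (∫ ‖w(a)‖²) · exp(∫ₐᵗ r)` for all `t ∈ [a, b]` — for a shear pulse of strain
`∫ₐᵇ r = γ` the kinetic energy of a linearised perturbation grows by at most `e^γ`.
[cite: MajdaBertozziCUP2002, §3.1.1 Prop. 3.1 with Lemma 3.1 (energy estimate and Grönwall); YoshidaKaneda2000, §II (4)-(5) ((α,β) = (1,1))] -/
theorem linearisedNS_integral_norm_sq_le_mul_exp_integral_of_shear (hν : 0 ≤ ν)
    (hu : IsSmoothSpaceTimeOn (Icc a b) u) (hudiv : ∀ t ∈ Icc a b, IsDivFree (u t))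
    (hw : IsSmoothSpaceTimeOn (Icc a b) w) (hq : IsSmoothSpaceTimeOn (Icc a b) q)
    (hwdiv : ∀ t ∈ Icc a b, IsDivFree (w t))
    (hlin : ∀ t ∈ Icc a b, ∀ x, timeDerivWithin (Icc a b) w t x + convect (u t) (w t) x +
      convect (w t) (u t) x = ν • laplacian (w t) x - gradient (q t) x)
    {k m : d} (hkm : k ≠ m) {c : ℝ → UnitAddTorus d → ℝ} {r : ℝ → ℝ}
    (h0 : ∀ t ∈ Icc a b, ∀ x, ∀ i, i ≠ k → partialDeriv i (u t) x = 0)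
    (hk : ∀ t ∈ Icc a b, ∀ x, partialDeriv k (u t) x = c t x • EuclideanSpace.single m (1 : ℝ))
    (hc : ∀ t ∈ Icc a b, ∀ x, |c t x| ≤ r t) (hr : ContinuousOn r (Icc a b))
    {t : ℝ} (ht : t ∈ Icc a b) :
    ∫ x, ‖w t x‖ ^ 2 ≤ (∫ x, ‖w a x‖ ^ 2) * Real.exp (∫ s in a..t, r s) := by
  rcases lt_or_ge a b with hab | hba
  · set E : ℝ → ℝ := fun s => ∫ x, ‖w s x‖ ^ 2 with hE_def
    set E' : ℝ → ℝ := fun s => -(2 * ν * gradNormSq (w s)) -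
      2 * ∫ x, ⟪convect (w s) (u s) x, w s x⟫_ℝ with hE'_def
    have hE : ∀ s ∈ Icc a b, HasDerivWithinAt E (E' s) (Icc a b) s := fun s hs =>
      linearisedNS_hasDerivWithinAt_integral_norm_sq hu hudiv hw hq hwdiv hlin hab hs
    have hE'le : ∀ s ∈ Icc a b, E' s ≤ r s * E s := by
      intro s hs
      have hws : IsSmooth (w s) := hw.isSmooth_slice hs
      have hus : IsSmooth (u s) := hu.isSmooth_slice hs
      have hpw : ∀ x, 2 * |⟪convect (w s) (u s) x, w s x⟫_ℝ| ≤ r s * ‖w s x‖ ^ 2 := fun x =>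
        (two_mul_abs_inner_convect_le_of_shear hus hkm (h0 s hs x) (hk s hs x)).trans
          (mul_le_mul_of_nonneg_right (hc s hs x) (sq_nonneg _))
      have hI : 2 * |∫ x, ⟪convect (w s) (u s) x, w s x⟫_ℝ| ≤ r s * E s := by
        calc 2 * |∫ x, ⟪convect (w s) (u s) x, w s x⟫_ℝ|
            ≤ 2 * ∫ x, |⟪convect (w s) (u s) x, w s x⟫_ℝ| := by
              gcongr
              exact abs_integral_le_integral_abs
          _ = ∫ x, 2 * |⟪convect (w s) (u s) x, w s x⟫_ℝ| := (integral_const_mul _ _).symm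
          _ ≤ ∫ x, r s * ‖w s x‖ ^ 2 := by
              refine integral_mono_of_nonneg (Eventually.of_forall fun x => by positivity)
                ((hws.norm_sq.integrable).const_mul (r s)) (Eventually.of_forall hpw)
          _ = r s * E s := integral_const_mul _ _
      have hgrad : 0 ≤ 2 * ν * gradNormSq (w s) := by
        have := gradNormSq_nonneg (w s)
        positivity
      have habs : -(2 * ∫ x, ⟪convect (w s) (u s) x, w s x⟫_ℝ) ≤
          2 * |∫ x, ⟪convect (w s) (u s) x, w s x⟫_ℝ| := by
        have := neg_abs_le (∫ x, ⟪convect (w s) (u s) x, w s x⟫_ℝ)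
        linarith
      show -(2 * ν * gradNormSq (w s)) - 2 * ∫ x, ⟪convect (w s) (u s) x, w s x⟫_ℝ ≤ r s * E s
      linarith
    exact le_mul_exp_integral_of_deriv_le_mul hE hE'le hr ht
  · have hta : t = a := le_antisymm (ht.2.trans hba) ht.1
    rw [hta, intervalIntegral.integral_same, Real.exp_zero, mul_one]

end Energy

end Torus

end Literature.Analysis.FunctionSpaces

end
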